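import Mathlib
import Literature.Computability.Complexity.RangeAvoidance
import Literature.Computability.Complexity.SignDegreeXor
import HarnessLib.Audit
import Summits.PneNP.PneNP.Theorems.PstarTyped
import Summits.PneNP.PneNP.Theorems.PstarSA2Blind
import Summits.PneNP.PneNP.Theorems.PstarSALevel

/-!
# ROUND-21 headline, assembled by name: linear-level Sherali–Adams does not solve `P⋆`-AVOID (cell `pnp-ideate`, p3)

FRONTIER range-avoidance ladder, restricted-model side of rung F-N3 — nothing here bears on `P` vs `NP`.

The cell's ROUND-21 target `PstarSALevel.TypedSALinearLevel` (T21.1, the Benabbas–Georgiou–Magen–Tulsiani transfer: on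
`(r, 3/2)`-boundary-expanding, simple-overlap, TYPED pure-`P⋆` instances every fibre is Sherali–Adams feasible at level
`r / c`) has exactly one consumer, recorded here so that the headline closes BY NAME the moment its two suppliers land:
* `ExpandingTypedExist` (T21.1′ in existence form — the only use of the probabilistic lemma): at every stretch `C` there are,
  for infinitely many `n`, typed pure-`P⋆` instances with `m ≥ C·n` (and `m > n`) that are `(n / c, 3/2)`-boundary expanding
  with simple overlaps.  (First-moment sketch, memo ROUND-20-SEED §9: a random typed instance has `|V(J)| ≥ 2.75|J|`, hence
  `|bdry J| ≥ 2|V(J)| − 4|J| ≥ 1.5|J|`, for all `|J| ≤ ηn`, `η = O(C)^{-4}`, w.h.p.; double overlaps are `Poisson(O(C²))`.)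
* `SALinearBlind` — the headline: at every linear stretch there are pure-`P⋆` instances possessing non-range points on which
  level-`n / c` Sherali–Adams is feasible for EVERY target; i.e. no SA-based certificate of level linear in `n` (the class
  containing the ROUND-19 isolation certificate and every bounded-degree local LP argument) solves `P⋆`-AVOID.
* `saLinearBlind_of : TypedSALinearLevel → ExpandingTypedExist → SALinearBlind` (the non-range point is pigeonhole,
  `PstarSA2Blind.exists_not_mem_range`).
-/

set_option linter.dupNamespace false

open Finset
open Literature.Computability.Complexity
open Summit.PneNP.PneNP.Theorems.PstarTyped (Typed)
open Summit.PneNP.PneNP.Theorems.PstarSA2Blind (exists_not_mem_range)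
open Summit.PneNP.PneNP.Theorems.PstarSALevel (SAFeasible BoundaryExpanding SimpleOverlap TypedSALinearLevel)

namespace Summit.PneNP.PneNP.Theorems.PstarSAHeadline

/-- **T21.1′ (existence form).**  At every stretch `C` there is a constant `c > 0` such that for infinitely many `n` some
typed pure-`P⋆` instance with `n < m` and `C·n ≤ m` outputs is `(n / c, 3/2)`-boundary expanding with simple overlaps.
(Random typed instances have this property with probability `≥ e^{-O(C²)}`; to be proved by a first-moment count.) -/
@[conjecture] def ExpandingTypedExist : Prop :=
  ∀ C : ℕ, ∃ c : ℕ, 0 < c ∧ ∀ N : ℕ, ∃ n, N ≤ n ∧ ∃ m, n < m ∧ C * n ≤ m ∧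
    ∃ I : LocalMap 4 n m, I.IsPure xorAndPred ∧ Typed I ∧ BoundaryExpanding (n / c) I ∧ SimpleOverlap I

/-- **The ROUND-21 headline.**  At every linear stretch `C` there is `c > 0` such that for infinitely many `n` some pure-`P⋆`
instance with `C·n ≤ m` outputs has a point outside its range and yet level-`n / c` Sherali–Adams is feasible for EVERY
target `y` — so no Sherali–Adams certificate of level linear in `n` separates range from non-range points. -/
def SALinearBlind : Prop :=
  ∀ C : ℕ, ∃ c : ℕ, 0 < c ∧ ∀ N : ℕ, ∃ n, N ≤ n ∧ ∃ m, C * n ≤ m ∧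
    ∃ I : LocalMap 4 n m, I.IsPure xorAndPred ∧ (∃ y, y ∉ I.range) ∧ ∀ y, SAFeasible (n / c) I y

/-- **Headline by name**: the BGMT transfer (T21.1) and the existence of expanding typed instances (T21.1′) give
`SALinearBlind`. -/
theorem saLinearBlind_of (h1 : TypedSALinearLevel) (h2 : ExpandingTypedExist) : SALinearBlind := by
  obtain ⟨c₀, hc₀, hSA⟩ := h1
  intro C
  obtain ⟨c₁, hc₁, hE⟩ := h2 C
  refine ⟨c₁ * c₀, Nat.mul_pos hc₁ hc₀, fun N => ?_⟩
  obtain ⟨n, hNn, m, hnm, hCm, I, hP, hT, hB, hS⟩ := hE N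
  refine ⟨n, hNn, m, hCm, I, hP, exists_not_mem_range I hnm, fun y => ?_⟩
  have h := hSA n m (n / c₁) I hP hT hB hS y
  rwa [Nat.div_div_eq_div_mul] at h

/-! ### Primed variants without `SimpleOverlap` (Q1 of prover-1, 2026-08-28)

`SimpleOverlap` (no two outputs share two variables) is Benabbas–Georgiou–Magen–Tulsiani's hypothesis for the SDP layer
(Claim 3.4) and their random model (Lemma 4.1); the Sherali–Adams construction (Lemma 3.2 / Thm 3.1) never uses it — a peel
needs only a constraint with `≥ 2` private variables (expansion) and pairwise independence of the local law on the `≤ 2` shared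
slots (purity).  So T21.1 is conjectured, and being proved, in the stronger primed form below, and the existence statement it is
paired with drops the condition too (no deletion / conditioning argument needed in the first-moment count). -/

/-- **T21.1′ (primed T21.1): `TypedSALinearLevel` with the `SimpleOverlap` hypothesis dropped** — unused by the construction;
needed only for the SDP layer (T21.1c), which also wants boundary ratio `7/4`. -/
@[conjecture] def TypedSALinearLevel' : Prop :=
  ∃ c : ℕ, 0 < c ∧ ∀ (n m r : ℕ) (I : LocalMap 4 n m), I.IsPure xorAndPred → Typed I →
    BoundaryExpanding r I → ∀ y : Fin m → Bool, SAFeasible (r / c) I y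

/-- The primed form implies the landed form. -/
theorem typedSALinearLevel_of_prime (h : TypedSALinearLevel') : TypedSALinearLevel := by
  obtain ⟨c, hc, h⟩ := h
  exact ⟨c, hc, fun n m r I hP hT hB _ y => h n m r I hP hT hB y⟩

/-- **Existence of expanding typed instances, without `SimpleOverlap`** (the form the first-moment count delivers). -/
@[conjecture] def ExpandingTypedExist' : Prop :=
  ∀ C : ℕ, ∃ c : ℕ, 0 < c ∧ ∀ N : ℕ, ∃ n, N ≤ n ∧ ∃ m, n < m ∧ C * n ≤ m ∧
    ∃ I : LocalMap 4 n m, I.IsPure xorAndPred ∧ Typed I ∧ BoundaryExpanding (n / c) I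

/-- The landed existence statement implies the primed one. -/
theorem expandingTypedExist_prime_of (h : ExpandingTypedExist) : ExpandingTypedExist' := by
  intro C
  obtain ⟨c, hc, hE⟩ := h C
  refine ⟨c, hc, fun N => ?_⟩
  obtain ⟨n, hNn, m, hnm, hCm, I, hP, hT, hB, _⟩ := hE N
  exact ⟨n, hNn, m, hnm, hCm, I, hP, hT, hB⟩

/-- **Headline by name, primed suppliers**: `TypedSALinearLevel' → ExpandingTypedExist' → SALinearBlind`. -/
theorem saLinearBlind_of' (h1 : TypedSALinearLevel') (h2 : ExpandingTypedExist') : SALinearBlind := by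
  obtain ⟨c₀, hc₀, hSA⟩ := h1
  intro C
  obtain ⟨c₁, hc₁, hE⟩ := h2 C
  refine ⟨c₁ * c₀, Nat.mul_pos hc₁ hc₀, fun N => ?_⟩
  obtain ⟨n, hNn, m, hnm, hCm, I, hP, hT, hB⟩ := hE N
  refine ⟨n, hNn, m, hCm, I, hP, exists_not_mem_range I hnm, fun y => ?_⟩
  have h := hSA n m (n / c₁) I hP hT hB y
  rwa [Nat.div_div_eq_div_mul] at h

end Summit.PneNP.PneNP.Theorems.PstarSAHeadline
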